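import Literature.NumberTheory.LFunctions.CriticalLineTwoThirds
import Literature.NumberTheory.LFunctions.ZeroCountingProofs
import HarnessLib

/-!
# RH-FREE — Alpöge–Furman 2026 ⇒ the critical-line proportion targets rh.S15 (`κ ≥ 2/3`, hence `przz_bound`, `conrey_bound`)

Topic `Literature/NumberTheory/LFunctions` (namespace `Literature.NumberTheory.LFunctions`). PROOF
LAYER glue between the statement file `CriticalLineTwoThirds.lean` ([AF26] Theorem A as the
claim `AlpogeFurman2026_simple_critical`, cumulative form) and the `liminf` vocabulary of
`ZeroCounting.lean` (`criticalLineProportion = κ = liminf N₀(T)/N(T)`; the named facts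
`przz_bound : 5/12 < κ`, `conrey_bound : 0.4088 ≤ κ`, `one_third_le_criticalLineProportion`,
`criticalLineProportion_pos`):

* `AlpogeFurman2026_simple_critical.two_thirds_le_criticalLineProportion` — the claim gives
  `2/3 ≤ κ` (dictionary `le_criticalLineProportion_iff` of `ZeroCountingLevinsonProofs.lean` and
  `N₀^s ≤ N₀`, `simpleCriticalZeroCount_le_criticalZeroCount`);
* `przz_bound_of_AlpogeFurman2026` — hence the Pratt–Robles–Zaharescu–Zeindler record
  `przz_bound` (`5/12 < 2/3`), until now resting on the mollified-mean-square fact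
  `PRZZ2020_mollified_meanSquare` (`LevinsonMethodPRZZMeanSquare.lean`), follows from the [AF26]
  claim alone — and with it `conrey_bound`, Levinson's third and Selberg's positivity
  (`przz_bound.conrey_levinson_selberg`, `ZeroCountingProofs.lean`):
  `AlpogeFurman2026_simple_critical.conrey_levinson_selberg`.

Nothing here is asserted: every theorem takes `(h : AlpogeFurman2026_simple_critical)`, an
unrefereed claim (`[claim: AlpogeFurman2026, status: under-review]` in the statement file). Nothing
here bears on the truth of RH. Cell `landau-siegel` §C (records table of topic r5): the record
`κ ≥ 2/3` supersedes `κ > 5/12` in the tree's own `liminf` currency.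

## References

* [AF26] L. Alpöge, R. Furman, *More than two thirds of the zeros of the Riemann zeta function are
  simple and on the critical line*, arXiv:2608.13637v2 (2026), Theorem A and the sentence
  "A fortiori `N₀^*(T,2T), N₀(T,2T), N^s(T,2T) ≥ (2/3 − o(1)) N(T,2T)`" (p. 2), §1.3 (records).
* K. Pratt, N. Robles, A. Zaharescu, D. Zeindler, Res. Math. Sci. 7 (2020), Thm. 1.1
  [`PrattRoblesZaharescuZeindler2020`] (tree: `przz_bound`, `ZeroCounting.lean`).
-/

open Filter

namespace Literature.NumberTheory.LFunctions

/-- **[AF26] Theorem A ⇒ `κ ≥ 2/3`**: from the claim `AlpogeFurman2026_simple_critical`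
(`(2/3 − ε) N(T) ≤ N₀^s(T)` for all large `T`), the critical-line proportion
`κ = liminf N₀(T)/N(T)` of `ZeroCounting.lean` satisfies `2/3 ≤ κ` (via `N₀^s ≤ N₀` and the
`liminf` dictionary `le_criticalLineProportion_iff`).
[cite: AlpogeFurman2026, Theorem A (p. 1–2), "a fortiori" sentence] -/
theorem AlpogeFurman2026_simple_critical.two_thirds_le_criticalLineProportion
    (h : AlpogeFurman2026_simple_critical) : 2 / 3 ≤ criticalLineProportion :=
  le_criticalLineProportion_iff.2 h.critical

/-- **[AF26] ⇒ the PRZZ record in `liminf` form**: the claim implies `przz_bound`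
(`5/12 < κ`), since `5/12 < 2/3 ≤ κ`. [cite: AlpogeFurman2026, §1.3 (p. 2) (records `5/12 → 2/3`)] -/
theorem przz_bound_of_AlpogeFurman2026 (h : AlpogeFurman2026_simple_critical) : przz_bound := by
  unfold przz_bound
  have h23 := h.two_thirds_le_criticalLineProportion
  linarith

/-- **[AF26] ⇒ Conrey's `0.4088`, Levinson's third and Selberg's positivity** for
`κ = criticalLineProportion`, through `przz_bound.conrey_levinson_selberg`.
[cite: AlpogeFurman2026, §1.3 (p. 2)] -/
theorem AlpogeFurman2026_simple_critical.conrey_levinson_selberg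
    (h : AlpogeFurman2026_simple_critical) :
    conrey_bound ∧ one_third_le_criticalLineProportion ∧ criticalLineProportion_pos :=
  (przz_bound_of_AlpogeFurman2026 h).conrey_levinson_selberg

end Literature.NumberTheory.LFunctions
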